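import Mathlib.Analysis.Normed.Operator.LinearIsometry
import Literature.MathematicalPhysics.QuantumFieldTheory.Balaban1983to89.B9SectCLatticeCarrier

/-!
# `Balaban1983to89.B9Eq335PureGaugeGradientRow` — T. Bałaban, *Propagators for lattice gauge theories in a background field*, Commun. Math. Phys. **99** (1985)
# 389–434 [Balaban1985BackgroundPropagators] (3.35)–(3.36) p. 396 (the regularity class: on every cube a GAUGE in which `U^u = e^{iηA}` with `A`, `∇^ηA` small),
# (3.23) p. 394, Thm 3.1 (3.42) p. 397 and p. 398 *«All these inequalities are invariant with respect to gauge transformations of U»*: **THE PURE-GAUGE TWIN OF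
# THE GRADIENT ROW BY ISOMETRIC CONJUGATION — for transporters `T(x, y) = g(x)g(y)⁻¹` built from fibre ISOMETRIES `g(x)`, a solution `u` of the covariant site
# equation `Σ_ν t²•((u x − T(x,x−e_ν)u(x−e_ν)) + (u x − T(x,x+e_ν)u(x+e_ν))) + m•u x = h x` is `g·v` for the solution `v = g⁻¹u` of the FLAT equation with datum
# `g⁻¹h` (same pointwise norms), and the covariant difference `‖T(x,x−e_ν)u(x−e_ν) − u(x)‖` IS the flat difference `‖v(x−e_ν) − v(x)‖`; hence EVERY flat
# solution-shape gradient-row letter (weight, constants arbitrary) holds VERBATIM for pure gauges** — the comparison background of storey J's ball step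
# (t4-ne9-idea-1 g121 §2 (BG)∕(PG): *«pure-gauge twin by unitary conjugation ([folklore])»*) on the chain's lattice `TSite d P`

statement-level skeleton of published theorems with citation tags; proofs where landed; nothing here is a claim about the Yang–Mills mass gap

CITATION HEADER (lean-in-tree rule).  Audit cell `pub-balaban`, sub-cell `t4`, BINDER row NE9; filed by NE9 crux-team LEAF PROVER 05
(`b2b-balaban-t4-ne9-formalise-leaf-05`, gen 82).  SOURCE READ first-hand in the held text layer [Balaban1985BackgroundPropagators]
(`paper:balaban1985-cmp99-background-propagators`, journal page = PDF page + 388): p. 396 (3.35) *«for an arbitrary cube □ … there exists a gauge transformation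
u on □ such that U^u = e^{iηA}, and … |A| < O(1)Mα₀(L^jη)⁻¹, |∇^ηA| < O(1)Mα₀(L^jη)⁻²»*; p. 398 *«All these inequalities are invariant with respect to gauge
transformations of U.»*  The lemma is [folklore] (a gauge transformation is an isometric change of variables in every fibre); nothing printed is a hypothesis.
DESIGN: the flat letter enters as a HYPOTHESIS `Hflat` over an ARBITRARY weight `W : TSite d P → ℝ` and direction-dependent constants `B ν` — the output shape of
`B5Eq129FreeResolventGradientRowSites.gradRow_tsite_of_tor` (this lineage, gen 82) — so that this file builds on `B9SectCLatticeCarrier` + Mathlib alone and composes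
with the (K∇) suppliers BY ONE TERM when they land.

WHY THIS FILE (cell context).  Storey J (`B9Eq342GradientRowBootstrap`, t4-ne9-idea-1 g121) represents `∇_U(χu)` at an output bond through the resolvent of the
COMPARISON background `U⁰` on the ball of print's (3.35) gauge — a PURE GAUGE in the given frame (implementation (PG): no gauge action on `G′(U)` is needed) —
and feeds the difference `U − U⁰` to (PERT) through `B9Eq373KatoPairedRemainder`.  The (K∇) letter it needs for `U⁰` is the flat one conjugated: this file.

WHAT IS PROVED (sorry-free; 0 `def`; [folklore]).  `V` a real normed space, `g : TSite d P → (V ≃ₗᵢ[ℝ] V)` (the gauge), `t m : ℝ`.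
* **`flat_equation_of_pureGauge`** — `u` solves the pure-gauge equation with datum `h` ⟹ `x ↦ (g x)⁻¹(u x)` solves the flat one with datum `x ↦ (g x)⁻¹(h x)`.
* **`norm_pureGauge_sub_eq`** — `‖(g x)((g y)⁻¹(u y)) − u x‖ = ‖(g y)⁻¹(u y) − (g x)⁻¹(u x)‖`.
* **`gradRow_pureGauge_of_flat`** — `Hflat` (flat solution-shape row: equation with `unshift`∕`shift`, data `‖k y‖ ≤ F·W y`, output `‖v(unshift ν x) − v x‖ ≤ B ν·F·W x`,
  for EVERY `v k F`) ⟹ the same letter for the pure-gauge equation: `‖(g x)((g(unshift ν x))⁻¹ u(unshift ν x)) − u x‖ ≤ B ν·F·W x`.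
HONEST SCOPE.  Plumbing; `Hflat` is NOT discharged here; one weight `W` (any function), one lattice; the chain instance (`adTransportW φ U⁰` with `U⁰(b) = g(b₋)g(b₊)⁻¹`,
`Ad` of a unitary an isometry of the trace norm) is NOT typed here.  NOT summit progress (cell pub-balaban: NE9 NOT PRINTED ∕ NOT PROVED; «NE9 ⇐ the named binders»;
row WALLED ON A MODEL (O-NE9-1; #5 UNRULED); spine PROVED 0∕9; rung (B)+1 finite T⁴ — NOT infinite volume, NOT mass gap, NOT BetaPertH, NOT Clay).  HONEST DEPENDENCY
(cell line): continuum YM on T⁴ ⇐ BetaPertH ∧ nine spine estimates (0/9 proved); BetaPertH ⇐ (D1) ∧ (D4) ∧ CAP+tail; G-an2-4 gates asym, D1 and NE2/3/4.  NEW file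
importing `B9SectCLatticeCarrier` and `Mathlib.Analysis.Normed.Operator.LinearIsometry` only; nothing modified.  Net new unproved facts: 0.
-/

noncomputable section

open scoped BigOperators

namespace Literature.MathematicalPhysics.QuantumFieldTheory.Balaban1983to89.B9Eq335PureGaugeGradientRow

open B4Sect5Torus (TSite)
open B9SectCLatticeCarrier (shift unshift)

variable {d : ℕ} {P : Fin d → ℕ} {V : Type*} [NormedAddCommGroup V] [NormedSpace ℝ V]

/-- **A PURE GAUGE IS A CHANGE OF VARIABLES**: if `u` solves the covariant site equation with transporters `g(x)g(y)⁻¹` and datum `h`, then `v = g⁻¹u` solves the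
FLAT equation with datum `g⁻¹h` (apply the isometry `(g x)⁻¹` to the equation at `x`). [folklore]
[cite: Balaban1985BackgroundPropagators, (3.23) p.394, (3.35) p.396, p.398] -/
theorem flat_equation_of_pureGauge (g : TSite d P → (V ≃ₗᵢ[ℝ] V)) {t m : ℝ} {u h : TSite d P → V}
    (hu : ∀ x, ∑ ν, t ^ 2 • ((u x - g x ((g (unshift ν x)).symm (u (unshift ν x)))) + (u x - g x ((g (shift ν x)).symm (u (shift ν x))))) +
      m • u x = h x) (x : TSite d P) :
    ∑ ν, t ^ 2 • ((((g x).symm (u x)) - (g (unshift ν x)).symm (u (unshift ν x))) + (((g x).symm (u x)) - (g (shift ν x)).symm (u (shift ν x)))) +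
      m • (g x).symm (u x) = (g x).symm (h x) := by
  have e := congr_arg (fun w => (g x).symm w) (hu x)
  simp only [map_add, map_sum, map_smul, map_sub, LinearIsometryEquiv.symm_apply_apply] at e
  exact e

/-- **THE COVARIANT DIFFERENCE IS THE FLAT DIFFERENCE OF THE GAUGED FIELD**: `‖(g x)((g y)⁻¹(u y)) − u x‖ = ‖(g y)⁻¹(u y) − (g x)⁻¹(u x)‖` (`g x` is an isometry and
`u x = (g x)((g x)⁻¹(u x))`). [folklore] [cite: Balaban1985BackgroundPropagators, (3.3) p.391, p.398] -/
theorem norm_pureGauge_sub_eq (g : TSite d P → (V ≃ₗᵢ[ℝ] V)) (u : TSite d P → V) (x y : TSite d P) :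
    ‖g x ((g y).symm (u y)) - u x‖ = ‖(g y).symm (u y) - (g x).symm (u x)‖ := by
  conv_lhs => rw [← (g x).apply_symm_apply (u x)]
  rw [← map_sub, LinearIsometryEquiv.norm_map]

/-- **THE PURE-GAUGE TWIN OF THE FLAT GRADIENT ROW (solution shape).**  Let `Hflat` be a flat solution-shape letter on `TSite d P` for a weight `W` and constants `B ν`:
every solution `v` of `Σ_ν t²•((v x − v(x−e_ν)) + (v x − v(x+e_ν))) + m•v x = k x` with `‖k y‖ ≤ F·W y` has `‖v(x−e_ν) − v(x)‖ ≤ B ν·F·W x`.  Then for every gauge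
`g` and every solution `u` of the PURE-GAUGE equation (transporters `g(x)g(y)⁻¹`) with datum `‖h y‖ ≤ F·W y`:
`‖g(x)(g(x−e_ν)⁻¹u(x−e_ν)) − u(x)‖ ≤ B ν·F·W x` — the same letter, same weight, same constants (print p. 398: gauge invariance of (3.42)).
Proof: `flat_equation_of_pureGauge` + `‖(g y)⁻¹(h y)‖ = ‖h y‖` + `norm_pureGauge_sub_eq`. [folklore]
[cite: Balaban1985BackgroundPropagators, Thm 3.1 (3.42) p.397, p.398, (3.35) p.396] -/
theorem gradRow_pureGauge_of_flat {t m : ℝ} {W : TSite d P → ℝ} {B : Fin d → ℝ}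
    (Hflat : ∀ (v k : TSite d P → V) (F : ℝ),
      (∀ x, ∑ ν, t ^ 2 • ((v x - v (unshift ν x)) + (v x - v (shift ν x))) + m • v x = k x) →
      (∀ y, ‖k y‖ ≤ F * W y) → ∀ (ν : Fin d) (x : TSite d P), ‖v (unshift ν x) - v x‖ ≤ B ν * F * W x)
    (g : TSite d P → (V ≃ₗᵢ[ℝ] V)) {u h : TSite d P → V}
    (hu : ∀ x, ∑ ν, t ^ 2 • ((u x - g x ((g (unshift ν x)).symm (u (unshift ν x)))) + (u x - g x ((g (shift ν x)).symm (u (shift ν x))))) +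
      m • u x = h x)
    {F : ℝ} (hh : ∀ y, ‖h y‖ ≤ F * W y) (ν : Fin d) (x : TSite d P) :
    ‖g x ((g (unshift ν x)).symm (u (unshift ν x))) - u x‖ ≤ B ν * F * W x := by
  have h := Hflat (fun y => (g y).symm (u y)) (fun y => (g y).symm (h y)) F (flat_equation_of_pureGauge g hu)
    (fun y => by rw [LinearIsometryEquiv.norm_map]; exact hh y) ν x
  rw [norm_pureGauge_sub_eq]
  exact h

end Literature.MathematicalPhysics.QuantumFieldTheory.Balaban1983to89.B9Eq335PureGaugeGradientRow

end
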